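import Summits.QuantumFields.BalabanUV.T4Continuum.Support.ShellMeasureLevelAssembly
import Summits.QuantumFields.BalabanUV.T4Continuum.Support.ShellMeasureHeadlines

/-!
# `T4Continuum.ShellMeasureRootCompositionSU2` — NE7c ROOT COMPOSITION, END-II (per slot, `G = SU(2)`): the per-slot
# anti-concentration (M1) for a REALIZED slot measure `(fieldMeasure P j SU2).withDensity F` from the CHART-LEVEL
# LEVEL DATA of every exterior section — the binders SM-L1…L6 of the skeleton, displayed — through the tree gauge,
# the block sections and the `SU(2)` exponential chart
# (cell `pub-balaban`, sub-cell `t4`, spine estimate NE7c (node U5b); lineage t4-ne7c-p1 = PROVER seat P1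
# «shell-measure route», generation 26; row S7b of the crew claim table `t4/b2b-balaban-t4-ne7c-p1/LEAVES-NE7c-P1.md`
# (`t4/T4-NE7c-TRIGGER.json` c1); ADDITIVE — imports `ShellMeasureLevelAssembly` (p206468) and `ShellMeasureHeadlines`
# (p203109) only; 0 `def`, 0 sorry; v1.1 = v1 p207698 + DV-3∕DV-5 of the crew referee's pass 1, append-only)

HONEST FRAMING.  Finite four-torus programme, rung (B)+1 only — NOT infinite volume, NOT a mass gap, NOT the Clay
problem, NOT summit progress; (B), `BetaPertHyp`, (B^μ) not consumed.  (M1) for BAŁABAN'S INDUCTIVELY DEFINED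
EFFECTIVE MEASURES is NOT PRINTED (GAPS G-ne7cp1-1), asserted by nobody, NOT moved here: this file COMPOSES, for one
slot whose realized measure is product Haar on the cell's `SU(2)` configuration space tilted by a gauge-invariant
density `F` (the run's (2.18)-integrand with the slot's own indicator removed — reading (R)), the kernel chain
  tree gauge `U ↦ U[T := U₀]` (`ShellMeasureScalingLocal.slotAntiConcentration_gaugeFixed_iff`, via
  `ShellMeasureHeadlines`) → block sections (`T4ShellMeasureDet.slotAntiConcentration_realized_of_sections`) → the
  exponential chart (`ShellMeasureScalingSU2.chart_su2` + `T4ShellMeasureDet.slotAntiConcentration_of_chart`) → the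
  one-depth assembly `ShellMeasureLevelAssembly.slotAntiConcentration_of_levelData`,
so that END-I's binder `hac` (`ShellMeasureRootComposition.shellWeightBound_of_slotAC`, row S7a) — (M1) per slot —
reads, for the cell's realized measures, AS THE LEVEL DATA BINDERS per exterior section `V`: SM-L1 (AN-bound)_j
`hAN`, SM-L2 (SM)_j `hSM`, SM-L3 graded sectioned words `hGW`, SM-L4 non-Wilson ray bound `hE`, SM-L5/SM-L6 in the
form «kept co-tests `Jco V` supported in the window and centre-monotone» `hJW`/`hJ` (dropped straddling co-tests go
through `T4ShellMeasureFibre.slotAntiConcentration_of_dominated` with a displayed mass ratio — row S2), plus the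
DICTIONARY hypotheses `hRdict`/`hudict` identifying the tree-gauged section's block weight and classifier with the
chart-level `weight`/`classifier` (their level-0 models: `ShellMeasureWilsonRealizedSU2.wilsonSum_chart_smul`,
`wilsonU_chart_smul`; `ShellMeasureWilsonGaugeInvariant` for the gauge-invariant density).  None of SM-L1…L6 is
instantiated at a live level; all are located, NOT PRINTED as numbers (G-ne7cp1-8a, -14, -9, -22, -26).  0 sorry,
0 citations.  HONEST DEPENDENCY (cell): continuum YM on T⁴ ⇐ BetaPertH ∧ nine spine estimates (0/9 proved); BetaPertH ⇐
(D1) ∧ (D4) ∧ CAP+tail; G-an2-4 gates asym, D1 and NE2/3/4.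

## What is proved ([folklore] bookkeeping)

* §1 `slotAC_realized_su2_of_chartAC`: realized (M1) from a CHART-LEVEL (M1) per exterior section (window
  factorisation `hFw`, chart identity `chart_su2`); `slotAC_realized_su2_of_chartAC_gauge`: the same for a
  gauge-invariant pair through the tree gauge (`T` loop-free, any `U₀`).
* §2 END-II `slotAC_realized_su2_of_levelData`: realized (M1) with constant `2(n + β Σ_p L̄_p(d̄_p + 4s̄_p) + B_𝓔)/(1−δ)`
  from the level data binders of every tree-gauged exterior section (generic complete normed `ℂ`-algebra `A` with a
  trace datum; `n` = number of chart coordinates).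

WHAT THIS DOES NOT DO.  No binder instantiated; (M1) NOT proved for any live level; NE7c NOT proved; 0/9 spine.
(LR)_j AT A LIVE LEVEL (v1.1, crew referee DV-5): the window factorisation `hFw` puts the product exponential BOND window
`expWindowDensity Λ (c V) S` about the chart centre INSIDE the realized density — at a live level `j ≥ 1` the window
insertion (LR)_j is thereby ASSUMED in the form of the weight (skeleton SM-L5 «open»); only at level 0 is the bond
window DERIVED from gauge-invariant plaquette co-tests (`ShellMeasureWilsonGaugeInvariant`, crew row S1).  v1.1 also
adds `slotAC_realized_su2_of_levelData'` with the (SM) binder in the clean form `36·H/(Rad − 1)² ≤ δθ` (DV-3).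
-/

noncomputable section

open NormedSpace Set Function MeasureTheory Metric

namespace Summit.QuantumFields.BalabanUV.T4Continuum.ShellMeasureRootCompositionSU2

open scoped ENNReal
open Literature.MathematicalPhysics.QuantumFieldTheory.Balaban1983to89
open GaugeField (GaugeInvariant)
open T4ShellMeasure (SlotAntiConcentration)
open T4CubePoincare (cube)
open T4CubeChartGnomonic (SU2)
open T4CubeChartExp (expJac expWindowDensity measurable_expWindowDensity expFibreChart continuous_expFibreChart)
open T4ShellMeasureDet (blockLaw slotAntiConcentration_of_chart slotAntiConcentration_realized_of_sections
  measurable_section)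
open T4TreeGaugeFixing (NoClosedLoop fixTo measurable_fixTo)
open ShellMeasureScalingLocal (slotAntiConcentration_gaugeFixed_iff)
open ShellMeasureScalingSU2 (chart_su2 chartLaw_univ_eq measurable_chartWeight mem_cube_of_chartWeight_ne_zero
  chartWeight_le_smul)
open ShellMeasureWilsonTrace (TraceData)
open ShellMeasureWilsonMoving (MLetter mwordEval mdFro sSum lSum)
open ShellMeasureLevelAssembly (classifier weight slotAntiConcentration_of_levelData)

variable {P : Params} {j : ℕ} [DecidableEq (PBond P j)]

/-! ## §1 Realized (M1) from a chart-level (M1) per exterior section -/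

/-- **REALIZED (M1) FROM CHART-LEVEL (M1), SECTION BY SECTION.**  Data: chart bonds `Λ` with an enumeration `e` of the
`n = 3·#Λ` coordinates; window half-side `S` (`0 < S`, `3S² < π²`); per exterior `V` a chart centre `c V` and a
measurable block weight `R V`; the realized density `F` with the window factorisation `hFw`; the tested variable `u`.
If for every exterior `V` the CHART LAW `Leb.withDensity (1_{[-S,S]ⁿ}·e^{−jac_e} · R V ∘ chart)` satisfies (M1) for the
variable read in the chart, then `(fieldMeasure P j SU2).withDensity F` satisfies (M1) for `u`, same constants
(`chart_su2` + `T4ShellMeasureDet.slotAntiConcentration_of_chart` + `slotAntiConcentration_realized_of_sections`).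
[folklore] -/
theorem slotAC_realized_su2_of_chartAC (Λ : Finset (PBond P j)) {n : ℕ} (e : ↥Λ × Fin 3 ≃ Fin n)
    {S : ℝ} (hS : 0 < S) (hSπ : 3 * S ^ 2 < Real.pi ^ 2) (c : GaugeField P j SU2 → GaugeField P j SU2)
    {R : GaugeField P j SU2 → (↥Λ → SU2) → ℝ≥0∞} (hR : ∀ V, Measurable (R V))
    {F : GaugeField P j SU2 → ℝ≥0∞} (hF : Measurable F)
    (hFw : ∀ V y, F (updateFinset V Λ y) =
      ENNReal.ofReal (expWindowDensity Λ (c V) S (updateFinset (c V) Λ y)) * R V y)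
    {u : GaugeField P j SU2 → ℝ} (hu : Measurable u) {θ ρ D : ℝ}
    (hchart : ∀ V, SlotAntiConcentration
      ((volume : Measure (Fin n → ℝ)).withDensity fun x =>
        (cube n S).indicator (fun x => ENNReal.ofReal (Real.exp (-expJac Λ e x))) x *
          R V (expFibreChart Λ (c V) e x))
      (fun x => u (updateFinset V Λ (expFibreChart Λ (c V) e x))) θ ρ D) :
    SlotAntiConcentration ((fieldMeasure P j SU2).withDensity F) u θ ρ D := by
  refine slotAntiConcentration_realized_of_sections Λ hF hu fun V => ?_
  have hκ : Measurable (expFibreChart Λ (c V) e) := (continuous_expFibreChart e).measurable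
  have hw : Measurable fun y : ↥Λ → SU2 =>
      ENNReal.ofReal (expWindowDensity Λ (c V) S (updateFinset (c V) Λ y)) :=
    ENNReal.measurable_ofReal.comp ((measurable_expWindowDensity Λ (c V) S).comp measurable_updateFinset)
  have hsecF : (fun y => F (updateFinset V Λ y)) =
      fun y => ENNReal.ofReal (expWindowDensity Λ (c V) S (updateFinset (c V) Λ y)) * R V y := funext (hFw V)
  have huV : Measurable fun y => u (updateFinset V Λ y) := measurable_section Λ hu V
  rw [hsecF]
  exact slotAntiConcentration_of_chart (blockLaw Λ) volume hκ (measurable_chartWeight e S) hw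
    (chart_su2 Λ (c V) e hS hSπ) (hR V) huV (hchart V)

/-- **… FOR A GAUGE-INVARIANT PAIR, THROUGH THE TREE GAUGE.**  `T` loop-free, any prescribed values `U₀`; the window
factorisation and the chart-level (M1) are asked of the TREE-GAUGED sections `V ↦ (F ∘ fixTo T U₀)(V[Λ := y])`,
`u ∘ fixTo T U₀` (`ShellMeasureScalingLocal.slotAntiConcentration_gaugeFixed_iff`). [folklore] -/
theorem slotAC_realized_su2_of_chartAC_gauge {T : Finset (PBond P j)} (hT : NoClosedLoop T)
    (U₀ : GaugeField P j SU2) (Λ : Finset (PBond P j)) {n : ℕ} (e : ↥Λ × Fin 3 ≃ Fin n)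
    {S : ℝ} (hS : 0 < S) (hSπ : 3 * S ^ 2 < Real.pi ^ 2) (c : GaugeField P j SU2 → GaugeField P j SU2)
    {R : GaugeField P j SU2 → (↥Λ → SU2) → ℝ≥0∞} (hR : ∀ V, Measurable (R V))
    {F : GaugeField P j SU2 → ℝ≥0∞} (hF : Measurable F) (hFi : GaugeInvariant F)
    (hFw : ∀ V y, F (fixTo T U₀ (updateFinset V Λ y)) =
      ENNReal.ofReal (expWindowDensity Λ (c V) S (updateFinset (c V) Λ y)) * R V y)
    {u : GaugeField P j SU2 → ℝ} (hu : Measurable u) (hui : GaugeInvariant u) {θ ρ D : ℝ}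
    (hchart : ∀ V, SlotAntiConcentration
      ((volume : Measure (Fin n → ℝ)).withDensity fun x =>
        (cube n S).indicator (fun x => ENNReal.ofReal (Real.exp (-expJac Λ e x))) x *
          R V (expFibreChart Λ (c V) e x))
      (fun x => u (fixTo T U₀ (updateFinset V Λ (expFibreChart Λ (c V) e x)))) θ ρ D) :
    SlotAntiConcentration ((fieldMeasure P j SU2).withDensity F) u θ ρ D :=
  (slotAntiConcentration_gaugeFixed_iff hT U₀ hF hFi hu hui).1
    (slotAC_realized_su2_of_chartAC Λ e hS hSπ c hR (hF.comp (measurable_fixTo T U₀)) hFw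
      (hu.comp (measurable_fixTo T U₀)) hchart)

/-! ## §2 END-II: realized (M1) from the LEVEL DATA of every tree-gauged exterior section -/

section EndTwo

variable {A : Type*} [NormedRing A] [NormedAlgebra ℂ A] [CompleteSpace A] [NormOneClass A]

/-- **END-II — REALIZED (M1) ⇐ SM-L1…L6 + DICTIONARY, PER SLOT (`G = SU(2)`).**  Data: tree `T` (loop-free),
prescribed values `U₀`; chart bonds `Λ`, enumeration `e` (`n` coordinates), window half-side `S`; per exterior `V` a
chart centre `c V` and a measurable block weight `R V`; a GAUGE-INVARIANT measurable realized density `F` with the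
window factorisation `hFw` of its tree-gauged sections and per-section finiteness `hfin`; a GAUGE-INVARIANT measurable
tested variable `u`.  LEVEL DATA per exterior `V`, in a complete normed `ℂ`-algebra `A` with trace datum `Ttr`
(`N > 0`): classifier plaquette functionals `hol V p` (`p ∈ P_u ≠ ∅`, continuous), weight plaquette words `G V p`
(`p ∈ P_w`), non-Wilson term `𝓔 V`, window `W V`, kept co-tests `Jco V`; sizes `s̄ ≤ 1`, `L̄, d̄ ≥ 0`; numbers
`θ > 0`, `0 ≤ δ < 1`, `0 ≤ ρ ≤ (1−δ)/2`, `β ≥ 0`, `Rad > 1`, `H`, `B_𝓔 ≥ 0`.  DICTIONARY: `hRdict` — on the chart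
the block weight IS `Jco V · weight Ttr β P_w (G V) (𝓔 V)`; `hudict` — the tested variable of the tree-gauged section
IS `classifier hPu (hol V)`.  BINDERS (the skeleton's estimate leaves, NOT instantiated): SM-L5/L6 `hJW`/`hJ` (co-tests
supported in `W V`, centre-monotone); SM-L1 `hAN` ((AN-bound)_j: analyticity–boundedness pairs `(Rad, H)` of the
classifier plaquette functionals along the complexified contraction, uniform in `V`); SM-L3 `hGW` (graded sectioned
words); SM-L4 `hE` (non-Wilson ray bound); SM-L2 `hSM` (`36H/(Rad−1)² ≤ δθ`).  CONCLUSION: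
`SlotAntiConcentration ((fieldMeasure P j SU2).withDensity F) u θ ρ (2(n + β Σ_p L̄_p(d̄_p + 4s̄_p) + B_𝓔)/(1−δ))` —
END-I's binder `hac` for this slot.  CONDITIONAL on every binder; nothing PRINTED is asserted. [folklore] -/
theorem slotAC_realized_su2_of_levelData {T : Finset (PBond P j)} (hT : NoClosedLoop T)
    (U₀ : GaugeField P j SU2) (Λ : Finset (PBond P j)) {n : ℕ} (e : ↥Λ × Fin 3 ≃ Fin n)
    {S : ℝ} (hS : 0 < S) (hSπ : 3 * S ^ 2 < Real.pi ^ 2) (c : GaugeField P j SU2 → GaugeField P j SU2)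
    {R : GaugeField P j SU2 → (↥Λ → SU2) → ℝ≥0∞} (hR : ∀ V, Measurable (R V))
    {F : GaugeField P j SU2 → ℝ≥0∞} (hF : Measurable F) (hFi : GaugeInvariant F)
    (hFw : ∀ V y, F (fixTo T U₀ (updateFinset V Λ y)) =
      ENNReal.ofReal (expWindowDensity Λ (c V) S (updateFinset (c V) Λ y)) * R V y)
    (hfin : ∀ V, ((blockLaw Λ).withDensity fun y => F (fixTo T U₀ (updateFinset V Λ y))) univ ≠ ∞)
    {u : GaugeField P j SU2 → ℝ} (hu : Measurable u) (hui : GaugeInvariant u)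
    -- level data per exterior section
    (Ttr : TraceData A) (hN : 0 < Ttr.N) {ι κ : Type*} {Pu : Finset ι} (hPu : Pu.Nonempty)
    (hol : GaugeField P j SU2 → ι → (Fin n → ℝ) → A) (hcont : ∀ V, ∀ p ∈ Pu, Continuous (hol V p))
    (Pw : Finset κ) (G : GaugeField P j SU2 → κ → (Fin n → ℝ) → A) (𝓔 : GaugeField P j SU2 → (Fin n → ℝ) → ℝ)
    (W : GaugeField P j SU2 → Set (Fin n → ℝ)) (Jco : GaugeField P j SU2 → (Fin n → ℝ) → ℝ≥0∞)
    {θ δ ρ β Rad H B𝓔 : ℝ} {sw lw dw : κ → ℝ}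
    -- DICTIONARY
    (hRdict : ∀ V x, R V (expFibreChart Λ (c V) e x) = Jco V x * weight Ttr β Pw (G V) (𝓔 V) x)
    (hudict : ∀ V x, u (fixTo T U₀ (updateFinset V Λ (expFibreChart Λ (c V) e x))) = classifier hPu (hol V) x)
    -- SM-L5/L6: kept co-tests supported in the window, centre-monotone
    (hJW : ∀ V x, Jco V x ≠ 0 → x ∈ W V)
    (hJ : ∀ V x, ∀ a : ℝ, 0 ≤ a → Jco V x ≤ Jco V (Real.exp (-a) • x))
    -- SM-L1 (AN-bound)
    (hRad : 1 < Rad)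
    (hAN : ∀ V, ∀ x ∈ W V, ∀ p ∈ Pu, ∃ f : ℂ → A, DifferentiableOn ℂ f (ball 0 Rad) ∧
      (∀ w ∈ ball (0 : ℂ) Rad, ‖f w‖ ≤ H) ∧ f 0 = 0 ∧ ∀ c' : ℝ, 0 ≤ c' → c' ≤ 1 → f (c' : ℂ) = hol V p (c' • x) - 1)
    -- SM-L3 graded sectioned words
    (hGW : ∀ V, ∀ x ∈ W V, ∀ p ∈ Pw, ∃ gw : List (MLetter A × ℝ × ℝ), (∀ y ∈ gw, y.1.Good Ttr.τ y.2.1 y.2.2) ∧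
      sSum gw ≤ sw p ∧ lSum gw ≤ lw p ∧ mdFro (gw.map Prod.fst) ≤ dw p ∧
      ∀ c' : ℝ, 0 ≤ c' → c' ≤ 1 → mwordEval c' (gw.map Prod.fst) = G V p (c' • x))
    (hsw1 : ∀ p ∈ Pw, sw p ≤ 1) (hsw0 : ∀ p ∈ Pw, 0 ≤ sw p) (hlw0 : ∀ p ∈ Pw, 0 ≤ lw p)
    (hdw0 : ∀ p ∈ Pw, 0 ≤ dw p)
    -- SM-L4 non-Wilson ray bound
    (hE : ∀ V, ∀ x ∈ W V, ∀ c' : ℝ, 1 / 2 ≤ c' → c' ≤ 1 → 𝓔 V (c' • x) ≤ 𝓔 V x + (1 - c') * B𝓔) (hB𝓔 : 0 ≤ B𝓔)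
    -- numbers + SM-L2 (SM)
    (hθ : 0 < θ) (hδ0 : 0 ≤ δ) (hδ1 : δ < 1) (hρ0 : 0 ≤ ρ) (hρ : ρ ≤ (1 - δ) / 2) (hβ : 0 ≤ β)
    (hSM : 36 * H * 1 ^ 2 / (Rad - 1) ^ 2 ≤ δ * θ) :
    SlotAntiConcentration ((fieldMeasure P j SU2).withDensity F) u θ ρ
      (2 * ((n : ℝ) + (β * ∑ p ∈ Pw, lw p * (dw p + 4 * sw p) + B𝓔)) / (1 - δ)) := by
  refine slotAC_realized_su2_of_chartAC_gauge hT U₀ Λ e hS hSπ c hR hF hFi hFw hu hui fun V => ?_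
  -- the chart law of the section, rewritten through the dictionary
  have hsecF : (fun y => F (fixTo T U₀ (updateFinset V Λ y))) =
      fun y => ENNReal.ofReal (expWindowDensity Λ (c V) S (updateFinset (c V) Λ y)) * R V y := funext (hFw V)
  have hdens : (fun x : Fin n → ℝ => (cube n S).indicator (fun x => ENNReal.ofReal (Real.exp (-expJac Λ e x))) x *
        R V (expFibreChart Λ (c V) e x)) =
      fun x => ((cube n S).indicator (fun x => ENNReal.ofReal (Real.exp (-expJac Λ e x))) x * Jco V x) *
        weight Ttr β Pw (G V) (𝓔 V) x := funext fun x => by rw [hRdict, mul_assoc]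
  have hcls : (fun x => u (fixTo T U₀ (updateFinset V Λ (expFibreChart Λ (c V) e x)))) = classifier hPu (hol V) :=
    funext (hudict V)
  rw [hdens, hcls]
  -- finiteness of the sub-threshold mass of the chart law (from the section's finite mass)
  have hfin' : ((volume : Measure (Fin n → ℝ)).withDensity fun x =>
      ((cube n S).indicator (fun x => ENNReal.ofReal (Real.exp (-expJac Λ e x))) x * Jco V x) *
        weight Ttr β Pw (G V) (𝓔 V) x) {x | classifier hPu (hol V) x < θ} ≠ ∞ := by
    refine ne_top_of_le_ne_top ?_ (measure_mono (subset_univ _))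
    rw [← hdens, chartLaw_univ_eq Λ (c V) e hS hSπ (hR V), ← hsecF]
    exact hfin V
  -- the one-depth assembly on the chart, window ∩ cube as the window, chart weight × co-tests as the factor
  have h := slotAntiConcentration_of_levelData (volume : Measure (Fin n → ℝ)) Ttr hN hPu (hol V) (hcont V) Pw (G V)
    (𝓔 V) (W := W V ∩ cube n S)
    (J := fun x => (cube n S).indicator (fun x => ENNReal.ofReal (Real.exp (-expJac Λ e x))) x * Jco V x)
    (fun x hx => ⟨hJW V x (right_ne_zero_of_mul hx), mem_cube_of_chartWeight_ne_zero (left_ne_zero_of_mul hx)⟩)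
    (fun x a ha => mul_le_mul' (chartWeight_le_smul e hSπ ha x) (hJ V x a ha)) hRad
    (fun x hx p hp => hAN V x hx.1 p hp) (fun x hx p hp => hGW V x hx.1 p hp) hsw1 hsw0 hlw0 hdw0
    (fun x hx c' h1 h2 => hE V x hx.1 c' h1 h2) hB𝓔 hθ hδ0 hδ1 hρ0 hρ hβ hSM hfin'
  simpa only [Module.finrank_fintype_fun_eq_card, Fintype.card_fin] using h

/-- **END-II, (SM) IN CLEAN FORM** (v1.1, crew referee DV-3): the same composition with the smallness binder written
`36·H/(Rad − 1)² ≤ δθ` instead of the `x₀ = 1` instantiation artefact `36·H·1²/(Rad − 1)²` of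
`ShellMeasureLevelAssembly.slotAntiConcentration_of_levelData`. [folklore] -/
theorem slotAC_realized_su2_of_levelData' {T : Finset (PBond P j)} (hT : NoClosedLoop T)
    (U₀ : GaugeField P j SU2) (Λ : Finset (PBond P j)) {n : ℕ} (e : ↥Λ × Fin 3 ≃ Fin n)
    {S : ℝ} (hS : 0 < S) (hSπ : 3 * S ^ 2 < Real.pi ^ 2) (c : GaugeField P j SU2 → GaugeField P j SU2)
    {R : GaugeField P j SU2 → (↥Λ → SU2) → ℝ≥0∞} (hR : ∀ V, Measurable (R V))
    {F : GaugeField P j SU2 → ℝ≥0∞} (hF : Measurable F) (hFi : GaugeInvariant F)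
    (hFw : ∀ V y, F (fixTo T U₀ (updateFinset V Λ y)) =
      ENNReal.ofReal (expWindowDensity Λ (c V) S (updateFinset (c V) Λ y)) * R V y)
    (hfin : ∀ V, ((blockLaw Λ).withDensity fun y => F (fixTo T U₀ (updateFinset V Λ y))) univ ≠ ∞)
    {u : GaugeField P j SU2 → ℝ} (hu : Measurable u) (hui : GaugeInvariant u)
    (Ttr : TraceData A) (hN : 0 < Ttr.N) {ι κ : Type*} {Pu : Finset ι} (hPu : Pu.Nonempty)
    (hol : GaugeField P j SU2 → ι → (Fin n → ℝ) → A) (hcont : ∀ V, ∀ p ∈ Pu, Continuous (hol V p))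
    (Pw : Finset κ) (G : GaugeField P j SU2 → κ → (Fin n → ℝ) → A) (𝓔 : GaugeField P j SU2 → (Fin n → ℝ) → ℝ)
    (W : GaugeField P j SU2 → Set (Fin n → ℝ)) (Jco : GaugeField P j SU2 → (Fin n → ℝ) → ℝ≥0∞)
    {θ δ ρ β Rad H B𝓔 : ℝ} {sw lw dw : κ → ℝ}
    (hRdict : ∀ V x, R V (expFibreChart Λ (c V) e x) = Jco V x * weight Ttr β Pw (G V) (𝓔 V) x)
    (hudict : ∀ V x, u (fixTo T U₀ (updateFinset V Λ (expFibreChart Λ (c V) e x))) = classifier hPu (hol V) x)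
    (hJW : ∀ V x, Jco V x ≠ 0 → x ∈ W V)
    (hJ : ∀ V x, ∀ a : ℝ, 0 ≤ a → Jco V x ≤ Jco V (Real.exp (-a) • x))
    (hRad : 1 < Rad)
    (hAN : ∀ V, ∀ x ∈ W V, ∀ p ∈ Pu, ∃ f : ℂ → A, DifferentiableOn ℂ f (ball 0 Rad) ∧
      (∀ w ∈ ball (0 : ℂ) Rad, ‖f w‖ ≤ H) ∧ f 0 = 0 ∧ ∀ c' : ℝ, 0 ≤ c' → c' ≤ 1 → f (c' : ℂ) = hol V p (c' • x) - 1)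
    (hGW : ∀ V, ∀ x ∈ W V, ∀ p ∈ Pw, ∃ gw : List (MLetter A × ℝ × ℝ), (∀ y ∈ gw, y.1.Good Ttr.τ y.2.1 y.2.2) ∧
      sSum gw ≤ sw p ∧ lSum gw ≤ lw p ∧ mdFro (gw.map Prod.fst) ≤ dw p ∧
      ∀ c' : ℝ, 0 ≤ c' → c' ≤ 1 → mwordEval c' (gw.map Prod.fst) = G V p (c' • x))
    (hsw1 : ∀ p ∈ Pw, sw p ≤ 1) (hsw0 : ∀ p ∈ Pw, 0 ≤ sw p) (hlw0 : ∀ p ∈ Pw, 0 ≤ lw p)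
    (hdw0 : ∀ p ∈ Pw, 0 ≤ dw p)
    (hE : ∀ V, ∀ x ∈ W V, ∀ c' : ℝ, 1 / 2 ≤ c' → c' ≤ 1 → 𝓔 V (c' • x) ≤ 𝓔 V x + (1 - c') * B𝓔) (hB𝓔 : 0 ≤ B𝓔)
    (hθ : 0 < θ) (hδ0 : 0 ≤ δ) (hδ1 : δ < 1) (hρ0 : 0 ≤ ρ) (hρ : ρ ≤ (1 - δ) / 2) (hβ : 0 ≤ β)
    (hSM : 36 * H / (Rad - 1) ^ 2 ≤ δ * θ) :
    SlotAntiConcentration ((fieldMeasure P j SU2).withDensity F) u θ ρ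
      (2 * ((n : ℝ) + (β * ∑ p ∈ Pw, lw p * (dw p + 4 * sw p) + B𝓔)) / (1 - δ)) :=
  slotAC_realized_su2_of_levelData hT U₀ Λ e hS hSπ c hR hF hFi hFw hfin hu hui Ttr hN hPu hol hcont Pw G 𝓔 W Jco
    hRdict hudict hJW hJ hRad hAN hGW hsw1 hsw0 hlw0 hdw0 hE hB𝓔 hθ hδ0 hδ1 hρ0 hρ hβ
    (by simpa only [one_pow, mul_one] using hSM)

end EndTwo

end Summit.QuantumFields.BalabanUV.T4Continuum.ShellMeasureRootCompositionSU2
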